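import Literature.Geometry.Riemannian.ParallelTransport
import Literature.Geometry.Riemannian.ExpMapIndexForm
import Literature.Geometry.Riemannian.ExpMapHopfRinow
import HarnessLib

/-!
# The Bonnet–Myers theorem: `Ric ≥ (n-1)k > 0` bounds minimizing geodesics and the diameter by `π/√k`
(topic `Geometry/Riemannian`)

Brick B3 of the convergence half (H1) of
`Literature.Geometry.Riemannian.hamilton_positiveCurvatureOperator_classification_four`
(`HamiltonPCOClassification.lean`, Hamilton 1986, Thm. 1.1): after the pinching and gradient
estimates, Hamilton 1982 (§15) and Huisken 1985 (§5) compare `R_max` and `R_min` along the Ricci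
flow by **Myers' theorem** — a lower Ricci bound `Rc ≥ (n-1)k g`, `k > 0`, forces every
minimizing geodesic to have length `≤ π/√k`, so the whole manifold lies within distance `π/√k`
of the point where `R` is maximal. This file PROVES Myers' theorem (Myers 1941; Lee 2018,
Thm. 11.16 "Conjugate Point Comparison II", Cor. 11.18 "Diameter Comparison" and Thm. 12.24;
Chavel 2006, Thm. III.4.3 / Remark III.4.1) for smooth Riemannian metrics on boundaryless
manifolds modelled on `𝓘(ℝ, E)`, `dim M ≥ 2`, by the Jacobi-tensor (Riccati) comparison of the
tree: the matrix layer `jacobi_noConjugate_length_le_pi` (`VolumeSphereTheoremProofs.lean`, §8)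
and its geometric feeding `normalJacobiTensor_frame_hyps` (`VolumeSphereTheoremJacobiFrameProofs.lean`,
§F15–§F19, written by another unit up to the CHART-LOCAL statement `noConjugate_length_le_pi_chart`),
made global by the parallel frames along whole geodesics of `ParallelTransport.lean`
(Lee 2018, Thm. 4.32), and rescaled from `Ric ≥ dim - 1` to `Ric ≥ (dim - 1)k`:

* `jacobi_noConjugate_length_mul_sqrt_le_pi` — the matrix layer for a general constant `k > 0`:
  `𝒜'' + ℛ𝒜 = 0`, `𝒜(0) = 0`, `𝒜'(0) = I`, `tr ℛ ≥ (card) k` and `det 𝒜 ≠ 0` on `(0, b)` give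
  `b √k ≤ π` (rescale `s = t√k` and apply the `k = 1` theorem);
* `exists_fullFrame_along_maximalGeodesic` — a full `g`-orthonormal frame along the WHOLE
  geodesic `γ_v` (`v` unit) on any `(a, b) ∋ 0`, headed by `γ̇_v`, with parallel normal part
  (the frame input of `normalJacobiTensor_frame`, globally; Chavel 2006, §III.1);
* `noConjugate_length_mul_sqrt_le_pi` — **Lee 2018, Thm. 11.16** along `γ_v`: if
  `Ric(γ̇_v, γ̇_v) ≥ (dim M - 1) k` on `(0, L)` and `d(exp_p)_{tv}` is injective for all
  `t ∈ (0, L)`, then `L √k ≤ π`;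
* `length_mul_sqrt_le_pi_of_isMinimizingUpTo` — **the form used by Hamilton and Huisken**: a
  geodesic segment `γ_u|[0, L]` (`u` unit) which is minimizing and along which
  `Ric(γ̇, γ̇) ≥ (dim M - 1) k` has `L √k ≤ π` (minimizing segments have no interior conjugate
  points, Lee 2018, Thm. 10.26 / `mfderiv_riemannianExpMap_injective_of_mem_injectivityDomain`);
* `edist_le_pi_div_sqrt_of_ricci_ge` — **Lee 2018, Cor. 11.18 / Thm. 12.24 (diameter part)**:
  on a connected manifold with complete Levi-Civita connection and `Rc(w, w) ≥ (dim M - 1) k g(w, w)`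
  everywhere, `d(p, q) ≤ π/√k` for all `p, q` (Hopf–Rinow, `exists_isMinimizingUpTo_of_isGeodesicallyComplete`);
  `edist_le_pi_div_sqrt_of_ricci_ge_of_compactSpace` — the same on a compact connected manifold,
  with the regularity instances of the smooth Levi-Civita connection supplied.

No definitions, no named facts (D-0026).

## References

* S. B. Myers, *Riemannian manifolds with positive mean curvature*, Duke Math. J. 8 (1941)
  401–404, doi:10.1215/S0012-7094-41-00832-3. [Myers1941]
* J. M. Lee, *Introduction to Riemannian Manifolds*, 2nd ed., GTM 176 (2018), Thm. 4.32,
  Thm. 10.26, Thm. 11.16, Cor. 11.18, Thm. 12.24. [LeeRiemannianManifolds2018]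
* I. Chavel, *Riemannian geometry: a modern introduction*, 2nd ed., CUP 2006, §III.1, Thm. III.4.3,
  Remark III.4.1. [Chavel2006]
* R. S. Hamilton, *Three-manifolds with positive Ricci curvature*, J. Differential Geom. 17
  (1982) 255–306, §15. [Hamilton1982]
* R. S. Hamilton, *Four-manifolds with positive curvature operator*, J. Differential Geom. 24
  (1986) 153–179, §2 (p. 154). [Hamilton1986]
-/

noncomputable section

open Bundle Set Filter Function
open scoped Manifold ContDiff Topology

namespace Literature.Geometry.Riemannian

open Literature.Geometry.Lorentzian Literature.Geometry.Lorentzian.PseudoRiemannianMetric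

/-! ### The matrix layer for a general positive constant -/

section MatrixLayer

open Matrix

open scoped Matrix.Norms.Operator

variable {ι : Type*} [Fintype ι] [DecidableEq ι] [Nonempty ι]

/-- **The Jacobi-tensor form of Bonnet–Myers for `tr ℛ ≥ (n-1) k`, `k > 0`** (Chavel 2006,
Remark III.4.1 with the model `S_k`; Lee 2018, proof of Thm. 11.16 with `c = 1/R² = k`): if
`𝒜' = 𝒜₁`, `𝒜₁' = -ℛ𝒜` on `(a, b) ∋ 0` with `ℛ` symmetric and continuous at `0`, `𝒜(0) = 0`,
`𝒜₁(0) = I`, `det 𝒜 ≠ 0` on `(0, b)` and `tr ℛ ≥ card(ι) · k` on `(0, b)`, then `b √k ≤ π`.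
Proof: the rescaled curves `s ↦ √k 𝒜(s/√k)`, `s ↦ 𝒜₁(s/√k)`, `s ↦ k⁻¹ ℛ(s/√k)` satisfy the
hypotheses of `jacobi_noConjugate_length_le_pi` (`k = 1`) on `(a√k, b√k)`.
[cite: Chavel2006, §III.4, Remark III.4.1] -/
theorem jacobi_noConjugate_length_mul_sqrt_le_pi {A A' R : ℝ → Matrix ι ι ℝ} {a b k : ℝ}
    (hk : 0 < k) (h0 : (0 : ℝ) ∈ Ioo a b)
    (hA : ∀ t ∈ Ioo a b, HasDerivAt A (A' t) t)
    (hA' : ∀ t ∈ Ioo a b, HasDerivAt A' (-(R t * A t)) t)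
    (hR : ∀ t ∈ Ioo a b, (R t).IsSymm) (hRc : ContinuousAt R 0)
    (hA0 : A 0 = 0) (hA'0 : A' 0 = 1)
    (hdet : ∀ t ∈ Ioo 0 b, (A t).det ≠ 0)
    (hRic : ∀ t ∈ Ioo 0 b, (Fintype.card ι : ℝ) * k ≤ (R t).trace) :
    b * Real.sqrt k ≤ Real.pi := by
  set c := Real.sqrt k with hc
  have hc0 : 0 < c := Real.sqrt_pos.2 hk
  have hck : c * c = k := Real.mul_self_sqrt hk.le
  have hkc : k⁻¹ * c = c⁻¹ := by
    rw [← hck, mul_inv, mul_assoc, inv_mul_cancel₀ hc0.ne', mul_one]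
  -- the parameter change `t = s / c`
  have hdiv : ∀ s : ℝ, HasDerivAt (fun s : ℝ ↦ s / c) c⁻¹ s := fun s ↦ by
    simpa [div_eq_mul_inv] using (hasDerivAt_id s).mul_const c⁻¹
  have hmem : ∀ {s : ℝ}, s ∈ Ioo (a * c) (b * c) → s / c ∈ Ioo a b := fun hs ↦
    ⟨(lt_div_iff₀ hc0).2 hs.1, (div_lt_iff₀ hc0).2 hs.2⟩
  have hmem0 : ∀ {s : ℝ}, s ∈ Ioo 0 (b * c) → s / c ∈ Ioo 0 b := fun hs ↦
    ⟨div_pos hs.1 hc0, (div_lt_iff₀ hc0).2 hs.2⟩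
  have h0' : (0 : ℝ) ∈ Ioo (a * c) (b * c) := ⟨mul_neg_of_neg_of_pos h0.1 hc0, mul_pos h0.2 hc0⟩
  -- the rescaled curves
  have hBd : ∀ s ∈ Ioo (a * c) (b * c),
      HasDerivAt (fun s ↦ c • A (s / c)) (A' (s / c)) s := by
    intro s hs
    have h1 := ((hA (s / c) (hmem hs)).scomp s (hdiv s)).const_smul c
    refine h1.congr_deriv ?_
    rw [smul_smul, mul_inv_cancel₀ hc0.ne', one_smul]
  have hB'd : ∀ s ∈ Ioo (a * c) (b * c),
      HasDerivAt (fun s ↦ A' (s / c)) (-((k⁻¹ • R (s / c)) * (c • A (s / c)))) s := by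
    intro s hs
    have h1 := (hA' (s / c) (hmem hs)).scomp s (hdiv s)
    refine h1.congr_deriv ?_
    rw [Matrix.smul_mul, Matrix.mul_smul, smul_smul, hkc, smul_neg]
  have hQs : ∀ s ∈ Ioo (a * c) (b * c), (k⁻¹ • R (s / c)).IsSymm :=
    fun s hs ↦ (hR _ (hmem hs)).smul _
  have hQc : ContinuousAt (fun s ↦ k⁻¹ • R (s / c)) 0 := by
    have h1 : ContinuousAt (fun s : ℝ ↦ R (s / c)) 0 := by
      have hf : ContinuousAt (fun s : ℝ ↦ s / c) 0 := (continuous_id.div_const c).continuousAt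
      have hR0 : ContinuousAt R ((fun s : ℝ ↦ s / c) 0) := by simpa using hRc
      exact ContinuousAt.comp hR0 hf
    exact h1.const_smul k⁻¹
  have hB0 : c • A (0 / c) = 0 := by rw [zero_div, hA0, smul_zero]
  have hB'0 : A' (0 / c) = 1 := by rw [zero_div, hA'0]
  have hdet' : ∀ s ∈ Ioo 0 (b * c), (c • A (s / c)).det ≠ 0 := by
    intro s hs
    rw [Matrix.det_smul]
    exact mul_ne_zero (pow_ne_zero _ hc0.ne') (hdet _ (hmem0 hs))
  have hRic' : ∀ s ∈ Ioo 0 (b * c), (Fintype.card ι : ℝ) ≤ (k⁻¹ • R (s / c)).trace := by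
    intro s hs
    rw [Matrix.trace_smul, smul_eq_mul, le_inv_mul_iff₀ hk, mul_comm]
    exact hRic _ (hmem0 hs)
  exact jacobi_noConjugate_length_le_pi (A := fun s ↦ c • A (s / c)) (A' := fun s ↦ A' (s / c))
    (R := fun s ↦ k⁻¹ • R (s / c)) h0' hBd hB'd hQs hQc hB0 hB'0 hdet' hRic'

end MatrixLayer

/-! ### Myers' theorem along a geodesic of a complete smooth metric -/

section Global

variable {E : Type*} [NormedAddCommGroup E] [NormedSpace ℝ E] [FiniteDimensional ℝ E]
  [CompleteSpace E] {M : Type*} [TopologicalSpace M] [ChartedSpace E M] [IsManifold 𝓘(ℝ, E) ∞ M]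
  [T2Space M]
  (g : PseudoRiemannianMetric 𝓘(ℝ, E) ∞ E (TangentSpace 𝓘(ℝ, E) : M → Type _)) [g.HasLeviCivita]
  [CovariantDerivative.ContMDiffCovariantDerivative g.leviCivita 1]
  [CovariantDerivative.ContMDiffCovariantDerivative g.leviCivita ∞]

omit [CovariantDerivative.ContMDiffCovariantDerivative g.leviCivita ∞] in
/-- **A full orthonormal frame along a whole geodesic** (Chavel 2006, §III.1: "a parallel
orthonormal frame field `{e₁, …, e_{n-1}, γ'}` along `γ`"; the frame input `f` of
`normalJacobiTensor_frame`, now without the one-chart restriction of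
`exists_fullFrame_along_geodesic`): for a smooth Riemannian metric with complete Levi-Civita
connection, a unit vector `v ∈ T_pM` and `a < 0 < b`, there are `k` and
`f(t) : Option (Fin k) → T_{γ_v t}M` with `f(t) none = γ̇_v(t)`, normal part parallel on `(a, b)`,
`g`-orthonormal on `(a, b)`, and `card (Option (Fin k)) = dim M`: transport a `g_p`-orthonormal
frame headed by `v` (`exists_orthonormal_frame_with_head`) along the whole of `γ_v`
(`exists_parallel_orthonormal_frame_maximalGeodesic`, Lee 2018, Thm. 4.32) and identify the
transported head with the parallel field `γ̇_v` (`eq_of_isParallelAlongOn`).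
[cite: Chavel2006, §III.1] -/
theorem exists_fullFrame_along_maximalGeodesic (hg : g.IsRiemannian)
    (hc : IsGeodesicallyComplete g.leviCivita) (p : M) (v : TangentSpace 𝓘(ℝ, E) p)
    (hv : g.val p v v = 1) {a b : ℝ} (h0 : (0 : ℝ) ∈ Ioo a b) :
    ∃ (k : ℕ) (f : Π t : ℝ, Option (Fin k) → TangentSpace 𝓘(ℝ, E) (maximalGeodesic g.leviCivita p v t)),
      (∀ t, f t none = velocity 𝓘(ℝ, E) (maximalGeodesic g.leviCivita p v) t) ∧
      (∀ i, IsParallelAlongOn g.leviCivita (maximalGeodesic g.leviCivita p v)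
        (fun t ↦ f t (some i)) (Ioo a b)) ∧
      (∀ t ∈ Ioo a b, ∀ o o', g.val (maximalGeodesic g.leviCivita p v t) (f t o) (f t o') =
        if o = o' then 1 else 0) ∧
      Fintype.card (Option (Fin k)) = Module.finrank ℝ E := by
  have hLC := PseudoRiemannianMetric.isLeviCivita_leviCivita_holds (g := g)
  obtain ⟨-, hgeo, hγ0, hγv⟩ := maximalGeodesic_of_isGeodesicallyComplete hc p v
  -- the frame at `p` headed by `v`, read at `γ_v 0 = p`, and transported along `γ_v`
  obtain ⟨k, f₀, hf₀none, hf₀on, hcard⟩ := exists_orthonormal_frame_with_head g hg p hv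
  have hf₀on' : ∀ o o', g.val (maximalGeodesic g.leviCivita p v 0) (f₀ o) (f₀ o') =
      if o = o' then 1 else 0 := by
    rw [hγ0]
    exact hf₀on
  obtain ⟨e', he'0, he'par, he'on⟩ :=
    exists_parallel_orthonormal_frame_maximalGeodesic g hg hc p v h0 f₀ hf₀on'
  -- the transported head is `γ̇_v`
  have hT : IsParallelAlongOn g.leviCivita (maximalGeodesic g.leviCivita p v)
      (fun t ↦ velocity 𝓘(ℝ, E) (maximalGeodesic g.leviCivita p v) t) (Ioo a b) :=
    (IsGeodesicOn.isParallelAlongOn_velocity hgeo).mono (subset_univ _)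
  have hhead : ∀ t ∈ Ioo a b, e' none t = velocity 𝓘(ℝ, E) (maximalGeodesic g.leviCivita p v) t := by
    intro t ht
    have h00 : e' none 0 = velocity 𝓘(ℝ, E) (maximalGeodesic g.leviCivita p v) 0 := by
      rw [he'0, hf₀none, hγv]
    exact eq_of_isParallelAlongOn g hg hLC.2 Set.ordConnected_Ioo (he'par none) hT h0 h00 ht
  refine ⟨k, fun t o ↦ o.elim (velocity 𝓘(ℝ, E) (maximalGeodesic g.leviCivita p v) t)
    (fun i ↦ e' (some i) t), fun t ↦ rfl, fun i ↦ he'par (some i), ?_, hcard⟩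
  intro t ht o o'
  have hon := he'on t ht
  rcases o with _ | i <;> rcases o' with _ | j
  · simpa [← hhead t ht] using hon none none
  · simpa [← hhead t ht] using hon none (some j)
  · simpa [← hhead t ht] using hon (some i) none
  · simpa using hon (some i) (some j)

/-- **Conjugate Point Comparison (Lee 2018, Thm. 11.16; Myers 1941), along `γ_v`, globally**:
for a smooth Riemannian metric with complete Levi-Civita connection, `dim M ≥ 2`, a unit vector
`v ∈ T_pM`, `k > 0` and `L > 0`: if `Ric(γ̇_v, γ̇_v) ≥ (dim M - 1) k` on `(0, L)` and `d(exp_p)`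
is injective at `t v` for every `t ∈ (0, L)` (no conjugate point before `L`), then `L √k ≤ π`
("every geodesic segment of length at least `πR` has a conjugate point", `k = 1/R²`). Proof:
`exists_fullFrame_along_maximalGeodesic`, `normalJacobiTensor_frame_hyps` (Chavel 2006,
Thm. III.4.3, set-up), `card_mul_le_sum_val_curvature_of_ricci_ge`, and the matrix layer
`jacobi_noConjugate_length_mul_sqrt_le_pi`.
[cite: LeeRiemannianManifolds2018, Thm. 11.16] -/
theorem noConjugate_length_mul_sqrt_le_pi (hg : g.IsRiemannian) (hdim : 2 ≤ Module.finrank ℝ E)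
    (hc : IsGeodesicallyComplete g.leviCivita) (p : M) (v : TangentSpace 𝓘(ℝ, E) p)
    (hv : g.val p v v = 1) {k L : ℝ} (hk : 0 < k) (hL : 0 < L)
    (hRic : ∀ t ∈ Ioo 0 L, ((Module.finrank ℝ E : ℝ) - 1) * k ≤
      g.leviCivita.ricci (maximalGeodesic g.leviCivita p v t)
        (velocity 𝓘(ℝ, E) (maximalGeodesic g.leviCivita p v) t)
        (velocity 𝓘(ℝ, E) (maximalGeodesic g.leviCivita p v) t))
    (hinj : ∀ t ∈ Ioo 0 L, Injective (mfderiv 𝓘(ℝ, E) 𝓘(ℝ, E)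
      (fun u : E ↦ expMap g.leviCivita p (show TangentSpace 𝓘(ℝ, E) p from u))
        (t • (show E from v)))) :
    L * Real.sqrt k ≤ Real.pi := by
  classical
  have hLC := PseudoRiemannianMetric.isLeviCivita_leviCivita_holds (g := g)
  have hreg1 : g.leviCivita.IsLocallyContMDiff 1 :=
    hLC.isLocallyContMDiff_one (WithTop.coe_le_coe.mpr le_top)
  have hinf : g.leviCivita.IsLocallyContMDiff (⊤ : ℕ∞) := hLC.isLocallyContMDiff ⊤ (le_of_eq rfl)
  have h2 : (2 : ℕ∞ω) ≤ ∞ := WithTop.coe_le_coe.2 le_top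
  have h0 : (0 : ℝ) ∈ Ioo (-1) L := ⟨by norm_num, hL⟩
  obtain ⟨k', f, hfnone, hfpar, hon, hcard⟩ :=
    exists_fullFrame_along_maximalGeodesic g hg hc p v hv h0
  haveI : Nonempty (Fin k') := nonempty_fin_of_card_option hcard hdim
  obtain ⟨J, hJ⟩ := normalJacobiTensor_frame_hyps g hreg1 hinf h2 hc p v h0 f hfnone hfpar hon
    hcard hinj
  obtain ⟨hA, hA', hR, hRc, hA0, hA'0, hdet, -⟩ := hJ
  -- the Ricci bound in the frame
  have hRic' : ∀ t ∈ Ioo 0 L, (Fintype.card (Fin k') : ℝ) * k ≤ (Matrix.of fun i j ↦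
      g.val (maximalGeodesic g.leviCivita p v t) (g.leviCivita.curvature
        (maximalGeodesic g.leviCivita p v t) (f t (some j))
        (velocity 𝓘(ℝ, E) (maximalGeodesic g.leviCivita p v) t)
        (velocity 𝓘(ℝ, E) (maximalGeodesic g.leviCivita p v) t)) (f t (some i))).trace := by
    intro t ht
    have hon' := hon t ⟨by linarith [ht.1], ht.2⟩
    have h := card_mul_le_sum_val_curvature_of_ricci_ge g g.leviCivita
      (maximalGeodesic g.leviCivita p v t) (κ := k) hon' hcard (by
        rw [hfnone t]
        have h1 : g.val (maximalGeodesic g.leviCivita p v t)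
            (velocity 𝓘(ℝ, E) (maximalGeodesic g.leviCivita p v) t)
            (velocity 𝓘(ℝ, E) (maximalGeodesic g.leviCivita p v) t) = 1 := by
          rw [← hfnone t, hon']; simp
        rw [h1, mul_one]; exact hRic t ht)
    simp only [Matrix.trace, Matrix.diag_apply, Matrix.of_apply]
    rw [hfnone t] at h
    exact h
  exact jacobi_noConjugate_length_mul_sqrt_le_pi hk h0 hA hA' hR hRc hA0 hA'0 hdet hRic'

/-- **Myers' theorem along a minimizing geodesic** (the form quoted by Hamilton 1982, §15 and
Huisken 1985, §5; Lee 2018, Thm. 11.16 with Thm. 10.26: "no geodesic segment of length `πR` or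
greater is minimizing" when `Ric ≥ (n-1)/R²` along it): for a smooth Riemannian metric with
complete Levi-Civita connection, `dim M ≥ 2`, a unit vector `u ∈ T_pM`, `k > 0`, `L > 0`: if
`γ_u|[0, L]` is minimizing (`IsMinimizingUpTo`) and `Ric(γ̇_u, γ̇_u) ≥ (dim M - 1) k` on `(0, L)`,
then `L √k ≤ π`. (For `0 < t < L`, `tu ∈ ID(p)` since `γ_{tu}` minimises up to `L/t > 1`, so
`d(exp_p)_{tu}` is injective, `mfderiv_riemannianExpMap_injective_of_mem_injectivityDomain`.)
[cite: LeeRiemannianManifolds2018, Thm. 11.16 and Thm. 10.26] [cite: Hamilton1982, §15] -/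
theorem length_mul_sqrt_le_pi_of_isMinimizingUpTo (hg : g.IsRiemannian)
    (hdim : 2 ≤ Module.finrank ℝ E) (hc : IsGeodesicallyComplete g.leviCivita) (p : M)
    (u : TangentSpace 𝓘(ℝ, E) p) (hu : g.val p u u = 1) {k L : ℝ} (hk : 0 < k) (hL : 0 < L)
    (hmin : IsMinimizingUpTo g hg p u L)
    (hRic : ∀ t ∈ Ioo 0 L, ((Module.finrank ℝ E : ℝ) - 1) * k ≤
      g.leviCivita.ricci (maximalGeodesic g.leviCivita p u t)
        (velocity 𝓘(ℝ, E) (maximalGeodesic g.leviCivita p u) t)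
        (velocity 𝓘(ℝ, E) (maximalGeodesic g.leviCivita p u) t)) :
    L * Real.sqrt k ≤ Real.pi := by
  refine noConjugate_length_mul_sqrt_le_pi g hg hdim hc p u hu hk hL hRic fun t ht ↦ ?_
  -- `t u ∈ ID(p)`: `γ_{tu}` minimises up to `L / t > 1`
  have ht0 : t ≠ 0 := ht.1.ne'
  have hID : t • u ∈ injectivityDomain g hg p := by
    refine ⟨L / t, (one_lt_div ht.1).2 ht.2, ?_⟩
    rw [isMinimizingUpTo_smul_iff hg hc p u ht.1, show t * (L / t) = L by field_simp]
    exact hmin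
  exact mfderiv_riemannianExpMap_injective_of_mem_injectivityDomain g le_rfl hg hc p hID

/-- **Diameter comparison (Lee 2018, Cor. 11.18; the diameter part of Myers' Thm. 12.24)**: for a
smooth Riemannian metric on a connected manifold with complete Levi-Civita connection,
`dim M ≥ 2`, and a constant `k > 0` with `Rc(w, w) ≥ (dim M - 1) k g(w, w)` for all tangent
vectors `w`, any two points satisfy `d(p, q) ≤ π/√k`: join them by a minimizing segment
`γ_v|[0,1]` (Hopf–Rinow, `exists_isMinimizingUpTo_of_isGeodesicallyComplete`), whose length
`|v| = d(p, q)` (`edist_eq_of_isMinimizingUpTo`) is at most `π/√k` by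
`length_mul_sqrt_le_pi_of_isMinimizingUpTo` applied to the unit-speed reparametrisation
(geodesics have constant speed). [cite: LeeRiemannianManifolds2018, Cor. 11.18 and Thm. 12.24] -/
theorem edist_le_pi_div_sqrt_of_ricci_ge [ConnectedSpace M] (hg : g.IsRiemannian)
    (hdim : 2 ≤ Module.finrank ℝ E) (hc : IsGeodesicallyComplete g.leviCivita) {k : ℝ}
    (hk : 0 < k)
    (hRic : ∀ (x : M) (w : TangentSpace 𝓘(ℝ, E) x),
      ((Module.finrank ℝ E : ℝ) - 1) * k * g.val x w w ≤ g.leviCivita.ricci x w w)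
    (p q : M) : g.edist hg p q ≤ ENNReal.ofReal (Real.pi / Real.sqrt k) := by
  have hLC := PseudoRiemannianMetric.isLeviCivita_leviCivita_holds (g := g)
  obtain ⟨v, hmin, hq⟩ := exists_isMinimizingUpTo_of_isGeodesicallyComplete g le_rfl hg hc p q
  have hd : g.edist hg p q = ENNReal.ofReal (Real.sqrt (g.val p v v)) := by
    have h1 : q = maximalGeodesic g.leviCivita p v 1 := by
      rw [← hq]
      exact expMap_eq_maximalGeodesic hc p v
    rw [h1, ← hmin.2, length_maximalGeodesic hg hc p v 0 1, sub_zero, one_mul]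
  rw [hd]
  apply ENNReal.ofReal_le_ofReal
  set ℓ := Real.sqrt (g.val p v v) with hℓ
  have hsk : 0 < Real.sqrt k := Real.sqrt_pos.2 hk
  rcases (show 0 ≤ ℓ from Real.sqrt_nonneg _).eq_or_lt with hℓ0 | hℓpos
  · rw [← hℓ0]; positivity
  -- the unit-speed reparametrisation `u = ℓ⁻¹ v`, minimizing up to `ℓ`
  have hvv0 : 0 ≤ g.val p v v := by
    by_cases hv : v = 0
    · simp [hv]
    · exact (hg p v hv).le
  have hvv : g.val p v v = ℓ ^ 2 := (Real.sq_sqrt hvv0).symm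
  set u : TangentSpace 𝓘(ℝ, E) p := ℓ⁻¹ • v with hu'
  have hu : g.val p u u = 1 := by
    have h1 : g.val p u u = ℓ⁻¹ * ℓ⁻¹ * g.val p v v := by
      rw [hu']
      simp only [map_smul, FunLike.coe_smul, Pi.smul_apply, smul_eq_mul]
      ring
    rw [h1, hvv]
    field_simp
  have hmin' : IsMinimizingUpTo g hg p u ℓ := by
    rw [hu', isMinimizingUpTo_smul_iff hg hc p v (inv_pos.2 hℓpos), inv_mul_cancel₀ hℓpos.ne']
    exact hmin
  -- the Ricci bound along `γ_u` (unit speed)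
  obtain ⟨-, hgeo, hγ0, hγu⟩ := maximalGeodesic_of_isGeodesicallyComplete hc p u
  have hspeed : ∀ t, g.val (maximalGeodesic g.leviCivita p u t)
      (velocity 𝓘(ℝ, E) (maximalGeodesic g.leviCivita p u) t)
      (velocity 𝓘(ℝ, E) (maximalGeodesic g.leviCivita p u) t) = 1 := by
    intro t
    rw [g.val_velocity_eq_of_isGeodesicOn_of_isCompatible hLC.2 isOpen_univ Set.ordConnected_univ
      hgeo (mem_univ t) (mem_univ 0), hγu]
    have : maximalGeodesic g.leviCivita p u 0 = p := hγ0
    rw [this]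
    exact hu
  have hRic' : ∀ t ∈ Ioo 0 ℓ, ((Module.finrank ℝ E : ℝ) - 1) * k ≤
      g.leviCivita.ricci (maximalGeodesic g.leviCivita p u t)
        (velocity 𝓘(ℝ, E) (maximalGeodesic g.leviCivita p u) t)
        (velocity 𝓘(ℝ, E) (maximalGeodesic g.leviCivita p u) t) := by
    intro t _
    have h := hRic _ (velocity 𝓘(ℝ, E) (maximalGeodesic g.leviCivita p u) t)
    rwa [hspeed t, mul_one] at h
  have hle := length_mul_sqrt_le_pi_of_isMinimizingUpTo g hg hdim hc p u hu hk hℓpos hmin' hRic'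
  rwa [le_div_iff₀ hsk]

end Global

/-! ### Compact manifolds: the regularity instances supplied -/

section Compact

variable {E : Type*} [NormedAddCommGroup E] [NormedSpace ℝ E] [FiniteDimensional ℝ E]
  [CompleteSpace E] {M : Type*} [TopologicalSpace M] [ChartedSpace E M] [IsManifold 𝓘(ℝ, E) ∞ M]
  [T2Space M] [CompactSpace M] [ConnectedSpace M]
  (g : PseudoRiemannianMetric 𝓘(ℝ, E) ∞ E (TangentSpace 𝓘(ℝ, E) : M → Type _)) [g.HasLeviCivita]

/-- **Myers' diameter bound on a closed manifold** (Lee 2018, Thm. 12.24 with Cor. 6.22; Myers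
1941): a compact connected boundaryless manifold of dimension `≥ 2` with a smooth Riemannian
metric satisfying `Rc(w, w) ≥ (dim M - 1) k g(w, w)`, `k > 0`, has `d(p, q) ≤ π/√k` for all
`p, q` — the Levi-Civita connection of a compact manifold is complete
(`hopfRinow_compact_geodesicallyComplete`) and `edist_le_pi_div_sqrt_of_ricci_ge` applies. This is
the form in which Hamilton 1982, §15 / Huisken 1985, §5 use Myers' theorem along the Ricci flow.
[cite: LeeRiemannianManifolds2018, Thm. 12.24] [cite: Hamilton1982, §15] -/
theorem edist_le_pi_div_sqrt_of_ricci_ge_of_compactSpace (hg : g.IsRiemannian)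
    (hdim : 2 ≤ Module.finrank ℝ E) {k : ℝ} (hk : 0 < k)
    (hRic : ∀ (x : M) (w : TangentSpace 𝓘(ℝ, E) x),
      ((Module.finrank ℝ E : ℝ) - 1) * k * g.val x w w ≤ g.leviCivita.ricci x w w)
    (p q : M) : g.edist hg p q ≤ ENNReal.ofReal (Real.pi / Real.sqrt k) := by
  have hk1 : ((1 : ℕ∞) : ℕ∞ω) + 1 ≤ ∞ := by
    rw [show ((1 : ℕ∞) : ℕ∞ω) + 1 = 2 by norm_num]
    exact WithTop.coe_le_coe.2 le_top
  haveI : CovariantDerivative.ContMDiffCovariantDerivative g.leviCivita 1 :=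
    ⟨g.isLocallyContMDiff_leviCivita_holds 1 hk1 univ isOpen_univ⟩
  haveI : CovariantDerivative.ContMDiffCovariantDerivative g.leviCivita ∞ :=
    ⟨g.isLocallyContMDiff_leviCivita_holds ⊤ (le_of_eq rfl) univ isOpen_univ⟩
  have hc : IsGeodesicallyComplete g.leviCivita := hopfRinow_compact_geodesicallyComplete le_rfl hg
  exact edist_le_pi_div_sqrt_of_ricci_ge g hg hdim hc hk hRic p q

end Compact

end Literature.Geometry.Riemannian

end
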